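import Mathlib
import Summits.Schanuel.Schanuel.Theorems.RigidCoreMinimalCounterexampleInAclHitSetIsolation
import Summits.Schanuel.Schanuel.Theorems.MinimalCounterexampleInAcl.Negative.KhovanskiiPoint

/-!
# The corank ≥ 2 hit pattern through an isolating rational box of `ℂⁿ`
# (crux stmt-Schanuel-0969 `RigidCore.MinimalCounterexampleInAcl`, line kernel-arithmetic-selection, lead c13)

`--supports stmt-Schanuel-0969`; registered stub `stub_corankGeTwo_hitSetBox`, the corank ≥ 2 port of the corank-one
presentation `mem_hitSet_iff_box` (Theorems/…HitSetIsolation).  Let `x ∈ ℂⁿ` be a first failure in normal form with log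
coordinates the indices `i < r`, `κ ∈ ℤⁿ`, and `Y_κ z = (x_i + 2πiκ_i)_{i<r} ⌢ (z_i)_{i≥r}` (`z ∈ ℂⁿ`, its coordinates
`i < r` are dummies).  For real functions `F`, `G_N` on `ℂⁿ` vanishing exactly where `Y_κ z ∈ locusPts x`, resp. where
moreover the integer relation `N` holds,

  `(∃ mate x' of x with x'_i = x_i + 2πiκ_i for i < r) ↔
     ∃ closed rational box B ⊆ ℂⁿ, (∃ z ∈ B, F z = 0) ∧ ∀ N ∈ ℤⁿ ∖ 0, ¬ ∃ z ∈ B, G_N z = 0`.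

The finiteness of the slice used in corank one is replaced by ISOLATION OF MATES: a mate `x'` of a first failure `x` is a
first failure with the same locus (`mate_firstFailure_voc`), and a first failure is an ISOLATED point of its own pulled-back
locus (`firstFailure_isolated_voc`: inverse function theorem at the non-degenerate Khovanskii point, tree
`firstFailure_khovanskii` + `hasStrictFDerivAt_khovanskiiMap`).  So a small sup-norm box around `x'` contains no other
point of `locusPts x`; every zero of `F` in it IS `x'`, hence ℚ-linearly independent, hence violates every `N ≠ 0`.

References: [Kirby2010] J. Kirby, *Exponential algebraicity in exponential fields*, Bull. LMS 42 (2010), Prop. 7.2,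
Remark 3.4; [Zilber2005] B. Zilber, *Pseudo-exponentiation on algebraically closed fields of characteristic zero*, APAL 132
(2005), Lemma 5.12.
-/

noncomputable section

-- the summit namespace `Summit.Schanuel.Schanuel.…` repeats a component by design (D-0022)
set_option linter.dupNamespace false

open Complex Set Filter Topology

namespace Summit.Schanuel.Schanuel.Cruxes.MinimalCounterexampleInAcl.KernelArithmeticSelection

open Literature.NumberTheory.Transcendental

variable {n : ℕ}

/-! ## Isolation of first failures and of mates -/

/-- **ISOLATION**: a first failure `x` is an isolated point of `𝒵_W = {z | (z, eᶻ) ∈ W}`: every `z ≠ x` close to `x`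
violates some ℚ-relation of `(x, eˣ)` (inverse function theorem at the non-degenerate Khovanskii point, tree
`firstFailure_khovanskii` and `hasStrictFDerivAt_khovanskiiMap`). [cite: Kirby2010, Prop. 7.2] -/
theorem firstFailure_isolated_voc {x : Fin n → ℂ} (hxli : LinearIndependent ℚ x)
    (htr : Algebra.trdeg ℚ ↥(IntermediateField.adjoin ℚ (range x ∪ range (cexp ∘ x))) < (n : Cardinal))
    (hrank : ∀ r < n, SchanuelRank r) :
    ∀ᶠ z in 𝓝[≠] x, ∃ p : MvPolynomial (Fin n ⊕ Fin n) ℚ,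
      MvPolynomial.aeval (Sum.elim x (cexp ∘ x)) p = 0 ∧
      MvPolynomial.aeval (Sum.elim z (cexp ∘ z)) p ≠ 0 := by
  -- adapted from Cruxes/MinimalCounterexampleInAcl/Disproof.lean §17 (`Khov.firstFailure_isolated`)
  classical
  obtain ⟨g, hg0, hdet⟩ :=
    Summit.Schanuel.Schanuel.Theorems.MinimalCounterexampleInAcl.Negative.firstFailure_khovanskii hxli htr hrank
  set f : Fin n → MvPolynomial (Fin n ⊕ Fin n) ℂ := fun i => MvPolynomial.map (algebraMap ℚ ℂ) (g i)
    with hf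
  have hmap : ∀ z : Fin n → ℂ, ∀ i, khovanskiiMap f z i =
      MvPolynomial.aeval (Sum.elim z (cexp ∘ z)) (g i) := by
    intro z i
    simp only [khovanskiiMap, hf]
    rw [MvPolynomial.eval_map, ← MvPolynomial.aeval_def]
    rfl
  have hjac : Khovanskii.kjac x f = Matrix.of fun i j =>
      MvPolynomial.aeval (Sum.elim x (cexp ∘ x)) (Khovanskii.ePD j (g i)) := by
    ext i j
    simp only [Khovanskii.kjac, Matrix.of_apply, hf]
    rw [Khovanskii.ePD_map, MvPolynomial.eval_map, ← MvPolynomial.aeval_def]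
    rfl
  have hx0 : khovanskiiMap f x = 0 := by
    funext i; rw [hmap, hg0 i]; rfl
  -- inverse function theorem at the non-degenerate point
  set A := LinearMap.toContinuousLinearMap (Matrix.toLin' (Khovanskii.kjac x f)) with hA
  have hAdet : A.det ≠ 0 := by
    rw [hA, ContinuousLinearMap.det, LinearMap.coe_toContinuousLinearMap, LinearMap.det_toLin', hjac]
    exact hdet
  have hF : HasStrictFDerivAt (khovanskiiMap f)
      ((A.toContinuousLinearEquivOfDetNeZero hAdet : (Fin n → ℂ) ≃L[ℂ] (Fin n → ℂ)) :
        (Fin n → ℂ) →L[ℂ] (Fin n → ℂ)) x := by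
    rw [ContinuousLinearMap.coe_toContinuousLinearEquivOfDetNeZero]
    exact hasStrictFDerivAt_khovanskiiMap f x
  have hx' : hF.localInverse _ _ _ (khovanskiiMap f x) = x := hF.localInverse_apply_image
  have hev : ∀ᶠ z in 𝓝 x, hF.localInverse _ _ _ (khovanskiiMap f z) = z := hF.eventually_left_inverse
  rw [eventually_nhdsWithin_iff]
  filter_upwards [hev] with z hz hne
  -- if all relations of `x` vanished at `z`, then `F z = 0 = F x`, so `z = x`
  by_contra hall
  push Not at hall
  apply hne
  have hz0 : khovanskiiMap f z = 0 := by
    funext i; rw [hmap]; exact hall (g i) (hg0 i)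
  calc z = hF.localInverse _ _ _ (khovanskiiMap f z) := hz.symm
    _ = hF.localInverse _ _ _ (khovanskiiMap f x) := by rw [hz0, hx0]
    _ = x := hx'

/-- **Mates are isolated in the pulled-back locus.**  If `x'` is a mate of the first failure `x`, then some `ε > 0` has:
every point of `locusPts x` within sup-distance `ε` of `x'` IS `x'` (`x'` is a first failure with `locusPts x' = locusPts x`,
`mate_firstFailure_voc`, and first failures are isolated, `firstFailure_isolated_voc`). [cite: Kirby2010, Prop. 7.2] -/
theorem exists_isolating_radius_of_mate {x x' : Fin n → ℂ} (hx : x ∈ firstFailures n) (hx' : x' ∈ locusMates x) :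
    ∃ ε : ℝ, 0 < ε ∧ ∀ y ∈ locusPts x, dist y x' < ε → y = x' := by
  obtain ⟨hff, hlocus⟩ := mate_firstFailure_voc hx hx'
  have hev := firstFailure_isolated_voc hff.1 hff.2.1 hff.2.2
  rw [eventually_nhdsWithin_iff, Metric.eventually_nhds_iff] at hev
  obtain ⟨ε, hε, hball⟩ := hev
  refine ⟨ε, hε, fun y hy hdist => ?_⟩
  by_contra hne
  obtain ⟨p, hp, hpy⟩ := hball hdist hne
  rw [← hlocus] at hy
  exact hpy (hy p hp)

/-! ## Rational boxes of `ℂⁿ` of small mesh -/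

/-- **A closed rational box of mesh `1/D` around a point of `ℂⁿ`, of sup-diameter `< ε`.**  For `x' ∈ ℂⁿ` and `ε > 0`
there are a denominator `D > 0` and integer corners `a_j ≤ re x'_j · D ≤ a_j + 1`, `c_j ≤ im x'_j · D ≤ c_j + 1` such that
every point of the box `∏ⱼ [a_j/D, (a_j+1)/D] × [c_j/D, (c_j+1)/D]` is within sup-distance `ε` of `x'`. [folklore] -/
theorem exists_int_box_near (x' : Fin n → ℂ) {ε : ℝ} (hε : 0 < ε) :
    ∃ (D : ℤ) (a c : Fin n → ℤ), 0 < D ∧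
      (∀ j : Fin n, (a j : ℝ) / D ≤ (x' j).re ∧ (x' j).re ≤ ((a j + 1 : ℤ) : ℝ) / D ∧
        (c j : ℝ) / D ≤ (x' j).im ∧ (x' j).im ≤ ((c j + 1 : ℤ) : ℝ) / D) ∧
      ∀ z : Fin n → ℂ, (∀ j : Fin n, (a j : ℝ) / D ≤ (z j).re ∧ (z j).re ≤ ((a j + 1 : ℤ) : ℝ) / D ∧
        (c j : ℝ) / D ≤ (z j).im ∧ (z j).im ≤ ((c j + 1 : ℤ) : ℝ) / D) → dist z x' < ε := by
  -- a denominator with `2 / D < ε`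
  obtain ⟨d, hd⟩ := exists_nat_gt (2 / ε)
  have hD0 : (0 : ℤ) < (d : ℤ) + 1 := by positivity
  have hDε : 2 / (((d : ℤ) + 1 : ℤ) : ℝ) < ε := by
    rw [div_lt_iff₀ (by positivity)]; push_cast
    rw [div_lt_iff₀ hε] at hd; nlinarith
  -- integer corners, coordinate by coordinate
  have hre := fun j : Fin n => exists_int_interval (x' j).re hD0
  have him := fun j : Fin n => exists_int_interval (x' j).im hD0
  choose a ha1 ha2 ha using hre
  choose c hc1 hc2 hc using him
  refine ⟨(d : ℤ) + 1, a, c, hD0, fun j => ⟨ha1 j, ha2 j, hc1 j, hc2 j⟩, fun z hz => ?_⟩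
  rw [dist_pi_lt_iff hε]
  intro j
  obtain ⟨h1, h2, h3, h4⟩ := hz j
  have hre' := ha j (z j).re h1 h2
  have him' := hc j (z j).im h3 h4
  rw [dist_eq_norm]
  calc ‖z j - x' j‖ ≤ |(z j - x' j).re| + |(z j - x' j).im| := Complex.norm_le_abs_re_add_abs_im _
    _ ≤ 1 / (((d : ℤ) + 1 : ℤ) : ℝ) + 1 / (((d : ℤ) + 1 : ℤ) : ℝ) := by
      rw [Complex.sub_re, Complex.sub_im]; exact add_le_add hre' him'
    _ = 2 / (((d : ℤ) + 1 : ℤ) : ℝ) := by ring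
    _ < ε := hDε

/-! ## The hit pattern through an isolating box -/

/-- Registered stub `stub_corankGeTwo_hitSetBox` of crux stmt-Schanuel-0969 (line kernel-arithmetic-selection, lead c13):
**the corank ≥ 2 hit pattern through an isolating rational box of `ℂⁿ`.**  For a first failure `x` of rank `n`, a number
`r` of log coordinates (the indices `i < r`), `κ ∈ ℤⁿ`, and any real functions `F`, `G_N` on `ℂⁿ` vanishing exactly where
`Y_κ z = (x_i + 2πiκ_i)_{i<r} ⌢ (z_i)_{i≥r}` lies in the pulled-back locus of `(x, eˣ)`, resp. lies there AND satisfies the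
integer relation `N`: some mate `x'` of `x` has log part `x'_i = x_i + 2πiκ_i` (`i < r`) iff some closed rational box of
`ℂⁿ` contains a zero of `F` and, for every `N ≠ 0`, no zero of `G_N` (isolation of mates gives the isolating box; the
converse is bookkeeping: a point of the locus all of whose integer relations are excluded is a mate).
[cite: Kirby2010, Prop. 7.2] -/
theorem stub_corankGeTwo_hitSetBox : ∀ (n r : ℕ) (x : Fin n → ℂ), x ∈ Summit.Schanuel.Schanuel.Cruxes.MinimalCounterexampleInAcl.KernelArithmeticSelection.firstFailures n → ∀ (κ : Fin n → ℤ) (F : (Fin n → ℂ) → ℝ) (G : (Fin n → ℤ) → (Fin n → ℂ) → ℝ), (∀ z : Fin n → ℂ, F z = 0 ↔ (fun i : Fin n => if (i : ℕ) < r then x i + 2 * ↑Real.pi * Complex.I * (κ i : ℂ) else z i) ∈ Summit.Schanuel.Schanuel.Cruxes.MinimalCounterexampleInAcl.KernelArithmeticSelection.locusPts x) → (∀ (N : Fin n → ℤ) (z : Fin n → ℂ), G N z = 0 ↔ (fun i : Fin n => if (i : ℕ) < r then x i + 2 * ↑Real.pi * Complex.I * (κ i : ℂ) else z i) ∈ Summit.Schanuel.Schanuel.Cruxes.MinimalCounterexampleInAcl.KernelArithmeticSelection.locusPts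 x ∧ ∑ i, (N i : ℂ) * (fun i : Fin n => if (i : ℕ) < r then x i + 2 * ↑Real.pi * Complex.I * (κ i : ℂ) else z i) i = 0) → ((∃ x' ∈ Summit.Schanuel.Schanuel.Cruxes.MinimalCounterexampleInAcl.KernelArithmeticSelection.locusMates x, ∀ i : Fin n, (i : ℕ) < r → x' i = x i + 2 * ↑Real.pi * Complex.I * (κ i : ℂ)) ↔ ∃ b : ((Fin n ⊕ Fin n) ⊕ (Fin n ⊕ Fin n)) ⊕ Fin 1 → ℤ, 0 < b (Sum.inr 0) ∧ (∃ z : Fin n → ℂ, (∀ j : Fin n, (((b (Sum.inl (Sum.inl (Sum.inl j)))) : ℤ) : ℝ) / (((b (Sum.inr 0)) : ℤ) : ℝ) ≤ (z j).re ∧ (z j).re ≤ (((b (Sum.inl (Sum.inl (Sum.inr j)))) : ℤ) : ℝ) / (((b (Sum.inr 0)) : ℤ) : ℝ) ∧ (((b (Sum.inl (Sum.inr (Sum.inl j)))) : ℤ) : ℝ) / (((b (Sum.inr 0)) : ℤ) : ℝ) ≤ (z j).im ∧ (z j).im ≤ (((b (Sum.inl (Sum.inr (Sum.inr j)))) : ℤ)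 : ℝ) / (((b (Sum.inr 0)) : ℤ) : ℝ)) ∧ F z = 0) ∧ ∀ N : Fin n → ℤ, N ≠ 0 → ¬ ∃ z : Fin n → ℂ, (∀ j : Fin n, (((b (Sum.inl (Sum.inl (Sum.inl j)))) : ℤ) : ℝ) / (((b (Sum.inr 0)) : ℤ) : ℝ) ≤ (z j).re ∧ (z j).re ≤ (((b (Sum.inl (Sum.inl (Sum.inr j)))) : ℤ) : ℝ) / (((b (Sum.inr 0)) : ℤ) : ℝ) ∧ (((b (Sum.inl (Sum.inr (Sum.inl j)))) : ℤ) : ℝ) / (((b (Sum.inr 0)) : ℤ) : ℝ) ≤ (z j).im ∧ (z j).im ≤ (((b (Sum.inl (Sum.inr (Sum.inr j)))) : ℤ) : ℝ) / (((b (Sum.inr 0)) : ℤ) : ℝ)) ∧ G N z = 0) := by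
  intro n r x hx κ F G hF hG
  constructor
  · -- an isolating box around a mate with the prescribed log part
    rintro ⟨x', hx', hx'κ⟩
    -- `Y_κ x' = x'`
    have hYx' : (fun i : Fin n => if (i : ℕ) < r then x i + 2 * ↑Real.pi * Complex.I * (κ i : ℂ) else x' i) = x' := by
      funext i
      by_cases hi : (i : ℕ) < r
      · rw [if_pos hi, hx'κ i hi]
      · rw [if_neg hi]
    obtain ⟨ε, hε, huniq⟩ := exists_isolating_radius_of_mate hx hx'
    obtain ⟨D, a, c, hD0, hx'b, hnear⟩ := exists_int_box_near x' hε
    -- every `Y_κ z` with `z` in the box is within `ε` of `x'`: the log coordinates agree, the others are those of `z`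
    have hYnear : ∀ z : Fin n → ℂ, (∀ j : Fin n, (a j : ℝ) / D ≤ (z j).re ∧ (z j).re ≤ ((a j + 1 : ℤ) : ℝ) / D ∧
        (c j : ℝ) / D ≤ (z j).im ∧ (z j).im ≤ ((c j + 1 : ℤ) : ℝ) / D) →
        dist (fun i : Fin n => if (i : ℕ) < r then x i + 2 * ↑Real.pi * Complex.I * (κ i : ℂ) else z i) x' < ε := by
      intro z hz
      have hzx := (dist_pi_lt_iff hε).1 (hnear z hz)
      rw [dist_pi_lt_iff hε]
      intro i
      by_cases hi : (i : ℕ) < r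
      · simp only [if_pos hi, ← hx'κ i hi, dist_self]
        exact hε
      · simp only [if_neg hi]
        exact hzx i
    refine ⟨Sum.elim (Sum.elim (Sum.elim a (fun j => a j + 1)) (Sum.elim c (fun j => c j + 1))) (fun _ => D), ?_,
      ⟨x', ?_, ?_⟩, fun N hN => ?_⟩
    · simpa only [Sum.elim_inr] using hD0
    · simp only [Sum.elim_inl, Sum.elim_inr]
      exact hx'b
    · rw [hF x', hYx']
      exact hx'.2
    · rintro ⟨z, hzb, hGz⟩
      simp only [Sum.elim_inl, Sum.elim_inr] at hzb
      obtain ⟨hzZ, hsum⟩ := (hG N z).1 hGz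
      -- the point `Y_κ z` of the locus is within `ε` of the mate `x'`, hence equals it
      have hYeq := huniq _ hzZ (hYnear z hzb)
      rw [hYeq] at hsum
      exact hN ((linearIndependent_iff_forall_int _).1 hx'.1 N hsum)
  · -- a point of the locus in the box all of whose integer relations are excluded is a mate
    rintro ⟨b, _hb, ⟨z, hzb, hFz⟩, hall⟩
    have hzZ := (hF z).1 hFz
    refine ⟨_, ⟨?_, hzZ⟩, fun i hi => by simp only [if_pos hi]⟩
    rw [mem_setOf_eq, linearIndependent_iff_forall_int]
    intro N hsum
    by_contra hN
    exact hall N hN ⟨z, hzb, (hG N z).2 ⟨hzZ, hsum⟩⟩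

end Summit.Schanuel.Schanuel.Cruxes.MinimalCounterexampleInAcl.KernelArithmeticSelection
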